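import Summits.RiemannHypothesis.RiemannHypothesis.Theorems.PfPersistenceEigenspaceTolerance
import Summits.RiemannHypothesis.RiemannHypothesis.Theorems.PfPersistenceConeContinuity
import Literature.MathematicalPhysics.QuantumFieldTheory.Balaban1983to89.B9Thm311
import HarnessLib

/-!
# PF persistence — SPACE CONTINUITY: thresholded continuous scale-free eigenvector readers are closed WITHOUT the
gap binder (pub-rhpf, barrier-prover gen 4; file 3 of the binder-free eigenvector wall)

**HONEST FRAMING. This is a long-odds MECHANISM SEARCH; no RH claims.** RH-free; every statement PROVED; no DATA.
The only non-theorem inputs are ORDINARY HYPOTHESES ON THE READER (continuity at `ζ`'s bottom eigenvectors,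
invariance under nonzero rescaling) and on `ζ`'s READING (strictly off the threshold at EVERY bottom vector of `ζ` at
the window) — hypotheses, never asserted. Nothing here bears on the truth of RH.

The gen-3 continuous-reader walls (`PfPersistenceConeContinuity`: `not_separates_of_reader_gt_subset`, …) carry the
NUMERICAL BINDER `HasBottomGap (zetaDatum win) u₀ γ` (certified simple bottom + gap). This file removes it:
* §1 UNIFORM CLEARANCE NEAR A SUBSPACE (`exists_tau_gt_of_nearSpace`): `E` a closed submodule of `Fin n → ℝ`, `Φ`
  scale-free, continuous at every nonzero point of `E` and `> θ` there ⇒ for some `τ > 0`, `Φ > θ` on the punctured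
  `NearSpace τ`-cone of `E`. Proof: the annulus `C := E ∩ {1/4 ≤ |e|² ≤ 4}` is compact; continuity gives an open
  cover of `C` on which `Φ > θ`; a THICKENING of `C` fits inside it (`IsCompact.exists_thickening_subset_open`); a
  unit vector `NearSpace τ`-close to `E` (`τ ≤ 1/16`, `τ < ρ²`) has its foot in the annulus (Cauchy–Schwarz,
  `B9Thm311.dot_sq_le` by name) at sup-distance `< ρ`.
* §2 THE WALLS, BINDER-FREE: for a reader `Φ` of the bottom vector at ONE window, scale-free and continuous at the
  nonzero points of `ζ`'s bottom eigenspace there, with `θ < Φ u` for EVERY bottom vector `u` of `ζ` at the window,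
  the classes `{d | ∀ u bottom of d win, θ < Φ u}` and `{d | ∃ u bottom of d win, θ < Φ u}` are robust at `ζ` within
  the dial space and separate `ζ` from the negatives of no `D ⊇ arithDialSpace`
  (`not_separates_of_spaceReader_gt_subset`, `…_exists_…`, `…_lt_…`, `…_between_…`), and the JOINT-READER form
  for the bottom vectors at finitely many windows (`exists_tau_tuple_gt_of_nearSpace`,
  `not_separates_of_tupleSpaceReader_gt_subset`: the gen-3 tuple wall with ALL `k` gap binders removed). At a window
  where `ζ`'s bottom is simple these are the gen-3 statements with the gap certificate replaced by nothing; at a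
  degenerate window the hypothesis 'off threshold at every bottom vector' is the honest residue (a reader whose
  threshold is crossed INSIDE `ζ`'s bottom eigenspace is not closed by continuity — and rejects `ζ` in its `∀` form).
HONEST RESIDUE (= gap class G1 / door E1, recorded not targeted): readers AT threshold on some bottom vector of `ζ`,
readers discontinuous at `ζ`'s eigenvectors (nodal COUNTS at a sign-degenerate eigenvector), and `∀`-window /
sliding-window readers (no uniform `τ`).
-/

set_option linter.dupNamespace false  -- the mandated namespace repeats `RiemannHypothesis`

noncomputable section

open Real Finset Matrix Set
open Literature.MathematicalPhysics.QuantumFieldTheory.Balaban1983to89.B9Thm311 (dot_sq_le)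

namespace Summit.RiemannHypothesis.RiemannHypothesis.Theorems.PfPersistence

/-! ## §1 Uniform clearance of a threshold near a subspace -/

/-- PROVED: normalising a nonzero real vector by `1/√(u·u)` gives a vector of squared length `1`. [folklore] -/
theorem dotSelf_sqrt_inv_smul {n : ℕ} {u : Fin n → ℝ} (hu : u ≠ 0) :
    ((Real.sqrt (u ⬝ᵥ u))⁻¹ • u) ⬝ᵥ ((Real.sqrt (u ⬝ᵥ u))⁻¹ • u) = 1 := by
  have hs : 0 < u ⬝ᵥ u := dotSelf_pos_of_ne_zero hu
  have hc2 : (Real.sqrt (u ⬝ᵥ u))⁻¹ * (Real.sqrt (u ⬝ᵥ u))⁻¹ = (u ⬝ᵥ u)⁻¹ := by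
    rw [← mul_inv, Real.mul_self_sqrt hs.le]
  rw [smul_dotProduct, dotProduct_smul, smul_eq_mul, smul_eq_mul, ← mul_assoc, hc2, inv_mul_cancel₀ hs.ne']

/-- PROVED: if a vector `v` of squared length `1` is within squared distance `1/16` of `e`, then `1/4 ≤ e·e ≤ 4`
(Cauchy–Schwarz `B9Thm311.dot_sq_le` BY NAME; the foot of a unit vector near a subspace lies in a fixed annulus).
[folklore] -/
theorem dotSelf_mem_annulus_of_near_unit {n : ℕ} {v e : Fin n → ℝ} (hv1 : v ⬝ᵥ v = 1)
    (hwe : (v - e) ⬝ᵥ (v - e) ≤ 1 / 16) : 1 / 4 ≤ e ⬝ᵥ e ∧ e ⬝ᵥ e ≤ 4 := by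
  have hcs : ((v - e) ⬝ᵥ v) ^ 2 ≤ 1 / 16 := by
    have h := dot_sq_le (v - e) v
    rw [hv1, mul_one] at h
    linarith
  have hb := abs_le_of_sq_le_sq' (show ((v - e) ⬝ᵥ v) ^ 2 ≤ (1 / 4) ^ 2 by
    rw [show ((1 : ℝ) / 4) ^ 2 = 1 / 16 by norm_num]; exact hcs) (by norm_num)
  have hee : e ⬝ᵥ e = 1 - 2 * ((v - e) ⬝ᵥ v) + (v - e) ⬝ᵥ (v - e) := by
    have e1 : e = v - (v - e) := by rw [sub_sub_cancel]
    conv_lhs => rw [e1]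
    simp only [sub_dotProduct, dotProduct_sub, dotProduct_comm e v]
    rw [hv1]
    ring
  have hw0 : 0 ≤ (v - e) ⬝ᵥ (v - e) := dotProduct_self_nonneg_real _
  constructor
  · rw [hee]; linarith [hb.2]
  · rw [hee]; linarith [hb.1]

/-- PROVED: a real vector with `e·e ≤ 4` lies in the closed sup-ball of radius `2`. [folklore] -/
theorem mem_closedBall_two_of_dotSelf_le {n : ℕ} {e : Fin n → ℝ} (he : e ⬝ᵥ e ≤ 4) :
    e ∈ Metric.closedBall (0 : Fin n → ℝ) 2 := by
  rw [Metric.mem_closedBall, dist_zero_right, pi_norm_le_iff_of_nonneg (by norm_num)]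
  intro i
  rw [Real.norm_eq_abs]
  refine abs_le_of_sq_le_sq ?_ (by norm_num)
  have := coord_sq_le_dotSelf e i
  linarith

/-- **PROVED — UNIFORM CLEARANCE NEAR A CLOSED SUBSPACE.** Let `E` be a closed submodule of `Fin n → ℝ` and `Φ` a
reader invariant under nonzero rescaling, continuous at every nonzero point of `E`, with `θ < Φ e` at every nonzero
`e ∈ E`. Then for some `τ > 0`, `θ < Φ u` for every `u ≠ 0` with `NearSpace τ u E`. (Compactness of the annulus
`E ∩ {1/4 ≤ |e|² ≤ 4}`, a thickening inside the open cover given by continuity, normalisation.) [folklore] -/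
theorem exists_tau_gt_of_nearSpace {n : ℕ} (E : Submodule ℝ (Fin n → ℝ)) (hE : IsClosed (E : Set (Fin n → ℝ)))
    {Φ : (Fin n → ℝ) → ℝ} (hΦ : ∀ e ∈ E, e ≠ 0 → ContinuousAt Φ e)
    (hscale : ∀ t : ℝ, t ≠ 0 → ∀ u : Fin n → ℝ, Φ (t • u) = Φ u) {θ : ℝ} (hθ : ∀ e ∈ E, e ≠ 0 → θ < Φ e) :
    ∃ τ : ℝ, 0 < τ ∧ ∀ u : Fin n → ℝ, u ≠ 0 → NearSpace τ u E → θ < Φ u := by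
  -- the compact annulus of `E`
  set C : Set (Fin n → ℝ) := (E : Set (Fin n → ℝ)) ∩ {e | 1 / 4 ≤ e ⬝ᵥ e ∧ e ⬝ᵥ e ≤ 4} with hC
  have hcont : Continuous fun e : Fin n → ℝ => e ⬝ᵥ e := continuous_id.dotProduct continuous_id
  have hCc : IsCompact C :=
    (isCompact_closedBall (0 : Fin n → ℝ) 2).of_isClosed_subset
      (hE.inter ((isClosed_le continuous_const hcont).inter (isClosed_le hcont continuous_const)))
      fun e he => mem_closedBall_two_of_dotSelf_le he.2.2
  have hCmem : ∀ p ∈ C, p ∈ E ∧ p ≠ 0 := by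
    rintro p ⟨hpE, hp1, -⟩
    refine ⟨hpE, fun h0 => ?_⟩
    rw [h0] at hp1
    simp only [dotProduct_zero] at hp1
    linarith
  -- continuity: around each point of `C` a ball on which `Φ > θ`
  have hballs : ∀ p : Fin n → ℝ, ∃ δ : ℝ, 0 < δ ∧ (p ∈ C → ∀ y : Fin n → ℝ, dist y p < δ → θ < Φ y) := by
    intro p
    by_cases hp : p ∈ C
    · obtain ⟨hpE, hp0⟩ := hCmem p hp
      have hgap : 0 < Φ p - θ := sub_pos.2 (hθ p hpE hp0)
      obtain ⟨δ, hδ, hball⟩ := Metric.continuousAt_iff.1 (hΦ p hpE hp0) (Φ p - θ) hgap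
      refine ⟨δ, hδ, fun _ y hy => ?_⟩
      have h := hball hy
      rw [Real.dist_eq] at h
      have := (abs_lt.1 h).1
      linarith
    · exact ⟨1, one_pos, fun h => absurd h hp⟩
  choose δ hδ hδΦ using hballs
  have hT : IsOpen (⋃ p ∈ C, Metric.ball p (δ p)) := isOpen_biUnion fun _ _ => Metric.isOpen_ball
  have hCT : C ⊆ ⋃ p ∈ C, Metric.ball p (δ p) := fun p hp => mem_iUnion₂.2 ⟨p, hp, Metric.mem_ball_self (hδ p)⟩
  obtain ⟨ρ, hρ, hthick⟩ := hCc.exists_thickening_subset_open hT hCT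
  -- the tolerance
  refine ⟨min (1 / 16) (ρ ^ 2 / 2), lt_min (by norm_num) (by positivity), fun u hu hnear => ?_⟩
  set τ := min (1 / 16) (ρ ^ 2 / 2) with hτ_def
  have hτ16 : τ ≤ 1 / 16 := min_le_left _ _
  have hτρ : τ < ρ ^ 2 := lt_of_le_of_lt (min_le_right _ _) (by nlinarith [hρ])
  -- unit vectors first
  have hunit : ∀ v : Fin n → ℝ, v ⬝ᵥ v = 1 → NearSpace τ v E → θ < Φ v := by
    intro v hv1 hv
    obtain ⟨e, he, hwe⟩ := hv
    rw [hv1, mul_one] at hwe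
    -- the foot `e` lies in the annulus, and `v` in the `ρ`-thickening of `C`
    have heC : e ∈ C := ⟨he, dotSelf_mem_annulus_of_near_unit hv1 (hwe.trans hτ16)⟩
    have hdist : dist v e < ρ := by
      rw [dist_eq_norm]
      exact norm_lt_of_dotSelf_lt_sq hρ (lt_of_le_of_lt hwe hτρ)
    have hvT := hthick (Metric.mem_thickening_iff.2 ⟨e, heC, hdist⟩)
    obtain ⟨p, hp, hvp⟩ := mem_iUnion₂.1 hvT
    exact hδΦ p hp v (Metric.mem_ball.1 hvp)
  -- normalise a general `u ≠ 0`
  have hne : (Real.sqrt (u ⬝ᵥ u))⁻¹ ≠ 0 := inv_ne_zero (Real.sqrt_pos.2 (dotSelf_pos_of_ne_zero hu)).ne'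
  have h := hunit _ (dotSelf_sqrt_inv_smul hu) (hnear.smul_left _)
  rwa [hscale _ hne u] at h

/-- PROVED: the same BELOW a threshold (apply the clearance lemma to `−Φ`). [folklore] -/
theorem exists_tau_lt_of_nearSpace {n : ℕ} (E : Submodule ℝ (Fin n → ℝ)) (hE : IsClosed (E : Set (Fin n → ℝ)))
    {Φ : (Fin n → ℝ) → ℝ} (hΦ : ∀ e ∈ E, e ≠ 0 → ContinuousAt Φ e)
    (hscale : ∀ t : ℝ, t ≠ 0 → ∀ u : Fin n → ℝ, Φ (t • u) = Φ u) {θ : ℝ} (hθ : ∀ e ∈ E, e ≠ 0 → Φ e < θ) :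
    ∃ τ : ℝ, 0 < τ ∧ ∀ u : Fin n → ℝ, u ≠ 0 → NearSpace τ u E → Φ u < θ := by
  obtain ⟨τ, hτ, h⟩ := exists_tau_gt_of_nearSpace E hE (Φ := fun u => -Φ u) (fun e he h0 => (hΦ e he h0).neg)
    (fun t ht u => by simp only [hscale t ht u]) (θ := -θ) (fun e he h0 => by linarith [hθ e he h0])
  exact ⟨τ, hτ, fun u hu hn => by linarith [h u hu hn]⟩

/-- **PROVED — UNIFORM CLEARANCE NEAR A PRODUCT OF CLOSED SUBSPACES** (joint readers of finitely many vectors): `E i`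
closed submodules, `Φ` a reader of tuples invariant under COMPONENTWISE nonzero rescaling, continuous at every tuple
with all components nonzero members of the `E i` and `> θ` there ⇒ for some `τ > 0`, `θ < Φ U` for every tuple
`U` with all components nonzero and `NearSpace τ`-close to the `E i` (product of annuli, compact by Tychonoff for a
finite product; sup metric on the product). [folklore] -/
theorem exists_tau_tuple_gt_of_nearSpace {k : ℕ} {m : Fin k → ℕ} (E : (i : Fin k) → Submodule ℝ (Fin (m i) → ℝ))
    (hE : ∀ i, IsClosed (E i : Set (Fin (m i) → ℝ))) {Φ : ((i : Fin k) → (Fin (m i) → ℝ)) → ℝ}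
    (hΦ : ∀ U : (i : Fin k) → (Fin (m i) → ℝ), (∀ i, U i ∈ E i ∧ U i ≠ 0) → ContinuousAt Φ U)
    (hscale : ∀ t : Fin k → ℝ, (∀ i, t i ≠ 0) → ∀ U : (i : Fin k) → (Fin (m i) → ℝ), Φ (fun i => t i • U i) = Φ U)
    {θ : ℝ} (hθ : ∀ U : (i : Fin k) → (Fin (m i) → ℝ), (∀ i, U i ∈ E i ∧ U i ≠ 0) → θ < Φ U) :
    ∃ τ : ℝ, 0 < τ ∧ ∀ U : (i : Fin k) → (Fin (m i) → ℝ), (∀ i, U i ≠ 0 ∧ NearSpace τ (U i) (E i)) → θ < Φ U := by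
  -- the compact product of annuli
  set C : Set ((i : Fin k) → (Fin (m i) → ℝ)) :=
    Set.pi Set.univ fun i => (E i : Set (Fin (m i) → ℝ)) ∩ {e | 1 / 4 ≤ e ⬝ᵥ e ∧ e ⬝ᵥ e ≤ 4} with hC
  have hCc : IsCompact C := by
    refine isCompact_univ_pi fun i => ?_
    have hcont : Continuous fun e : Fin (m i) → ℝ => e ⬝ᵥ e := continuous_id.dotProduct continuous_id
    exact (isCompact_closedBall (0 : Fin (m i) → ℝ) 2).of_isClosed_subset
      ((hE i).inter ((isClosed_le continuous_const hcont).inter (isClosed_le hcont continuous_const)))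
      fun e he => mem_closedBall_two_of_dotSelf_le he.2.2
  have hCmem : ∀ p ∈ C, ∀ i, p i ∈ E i ∧ p i ≠ 0 := by
    intro p hp i
    obtain ⟨hpE, hp1, -⟩ := Set.mem_univ_pi.1 hp i
    refine ⟨hpE, fun h0 => ?_⟩
    rw [h0] at hp1
    simp only [dotProduct_zero] at hp1
    linarith
  -- continuity: around each point of `C` a ball on which `Φ > θ`
  have hballs : ∀ p : (i : Fin k) → (Fin (m i) → ℝ), ∃ δ : ℝ, 0 < δ ∧
      (p ∈ C → ∀ y : (i : Fin k) → (Fin (m i) → ℝ), dist y p < δ → θ < Φ y) := by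
    intro p
    by_cases hp : p ∈ C
    · have hgap : 0 < Φ p - θ := sub_pos.2 (hθ p (hCmem p hp))
      obtain ⟨δ, hδ, hball⟩ := Metric.continuousAt_iff.1 (hΦ p (hCmem p hp)) (Φ p - θ) hgap
      refine ⟨δ, hδ, fun _ y hy => ?_⟩
      have h := hball hy
      rw [Real.dist_eq] at h
      have := (abs_lt.1 h).1
      linarith
    · exact ⟨1, one_pos, fun h => absurd h hp⟩
  choose δ hδ hδΦ using hballs
  have hT : IsOpen (⋃ p ∈ C, Metric.ball p (δ p)) := isOpen_biUnion fun _ _ => Metric.isOpen_ball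
  have hCT : C ⊆ ⋃ p ∈ C, Metric.ball p (δ p) := fun p hp => mem_iUnion₂.2 ⟨p, hp, Metric.mem_ball_self (hδ p)⟩
  obtain ⟨ρ, hρ, hthick⟩ := hCc.exists_thickening_subset_open hT hCT
  -- the tolerance
  refine ⟨min (1 / 16) (ρ ^ 2 / 2), lt_min (by norm_num) (by positivity), fun U hU => ?_⟩
  set τ := min (1 / 16) (ρ ^ 2 / 2) with hτ_def
  have hτ16 : τ ≤ 1 / 16 := min_le_left _ _
  have hτρ : τ < ρ ^ 2 := lt_of_le_of_lt (min_le_right _ _) (by nlinarith [hρ])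
  -- tuples of unit vectors first
  have hunit : ∀ V : (i : Fin k) → (Fin (m i) → ℝ), (∀ i, V i ⬝ᵥ V i = 1) →
      (∀ i, NearSpace τ (V i) (E i)) → θ < Φ V := by
    intro V hV1 hV
    choose e he hwe using hV
    have heC : e ∈ C := Set.mem_univ_pi.2 fun i =>
      ⟨he i, dotSelf_mem_annulus_of_near_unit (hV1 i) (by have := hwe i; rw [hV1 i, mul_one] at this; linarith)⟩
    have hdist : dist V e < ρ := by
      rw [dist_pi_lt_iff hρ]
      intro i
      rw [dist_eq_norm]
      refine norm_lt_of_dotSelf_lt_sq hρ (lt_of_le_of_lt ?_ hτρ)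
      have := hwe i
      rwa [hV1 i, mul_one] at this
    have hVT := hthick (Metric.mem_thickening_iff.2 ⟨e, heC, hdist⟩)
    obtain ⟨p, hp, hVp⟩ := mem_iUnion₂.1 hVT
    exact hδΦ p hp V (Metric.mem_ball.1 hVp)
  -- normalise a general tuple componentwise
  have hne : ∀ i, (Real.sqrt (U i ⬝ᵥ U i))⁻¹ ≠ 0 := fun i =>
    inv_ne_zero (Real.sqrt_pos.2 (dotSelf_pos_of_ne_zero (hU i).1)).ne'
  have h := hunit (fun i => (Real.sqrt (U i ⬝ᵥ U i))⁻¹ • U i) (fun i => dotSelf_sqrt_inv_smul (hU i).1)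
    (fun i => (hU i).2.smul_left _)
  rwa [hscale _ hne U] at h

/-! ## §2 The binder-free walls for thresholded continuous scale-free eigenvector readers -/

/-- **PROVED — ROBUSTNESS, BINDER-FREE.** A reader `Φ` of the bottom vector at ONE window, scale-free and continuous
at the nonzero points of `ζ`'s bottom eigenspace there, with `θ < Φ u` for EVERY bottom vector `u` of `ζ` at the
window: the class `{d | ∀ u bottom of d win, θ < Φ u}` is robust at `ζ` within the dial space. [folklore] -/
theorem robustWithin_dialSpace_spaceReader_gt (win : Window) {Φ : (Fin (win.N + 1) → ℝ) → ℝ}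
    (hΦ : ∀ u, IsBottomVector (zetaDatum win) u → ContinuousAt Φ u)
    (hscale : ∀ t : ℝ, t ≠ 0 → ∀ u : Fin (win.N + 1) → ℝ, Φ (t • u) = Φ u) {θ : ℝ}
    (hθ : ∀ u, IsBottomVector (zetaDatum win) u → θ < Φ u) :
    RobustWithin dialSpace {d | ∀ u, IsBottomVector (d win) u → θ < Φ u} zetaDatum := by
  obtain ⟨τ, hτ, hcone⟩ := exists_tau_gt_of_nearSpace (bottomSpace (zetaDatum win))
    (isClosed_bottomSpace _) (fun e he h0 => hΦ e ⟨h0, he⟩) hscale (fun e he h0 => hθ e ⟨h0, he⟩)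
  refine (robustWithin_dialSpace_esToleranceClass_zeta (fun _ : Fin 1 => win) hτ).mono ?_
  rintro d ⟨hd, -⟩ u hu
  exact hcone u hu.1 ((hd 0).2 u hu)

/-- **PROVED — THE WALL FOR A THRESHOLDED CONTINUOUS SCALE-FREE READER OF THE BOTTOM VECTOR AT ONE WINDOW, NO GAP
BINDER, `ζ`'s reading strictly above the threshold at every bottom vector** (universal form; dichotomy-carried,
otherwise UNCONDITIONAL). [folklore] -/
theorem not_separates_of_spaceReader_gt_subset (win : Window) {Φ : (Fin (win.N + 1) → ℝ) → ℝ}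
    (hΦ : ∀ u, IsBottomVector (zetaDatum win) u → ContinuousAt Φ u)
    (hscale : ∀ t : ℝ, t ≠ 0 → ∀ u : Fin (win.N + 1) → ℝ, Φ (t • u) = Φ u) {θ : ℝ}
    (hθ : ∀ u, IsBottomVector (zetaDatum win) u → θ < Φ u) {S D : Set Datum}
    (hS : {d | ∀ u, IsBottomVector (d win) u → θ < Φ u} ∩ arithDialSpace ⊆ S) (hD : arithDialSpace ⊆ D) :
    ¬ Separates S D zetaDatum :=
  not_separates_of_robustWithin_arith hD
    (((robustWithin_dialSpace_spaceReader_gt win hΦ hscale hθ).anti arithDialSpace_subset_dialSpace).mono hS)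

/-- **PROVED — the existential form** (`∃ u bottom, θ < Φ u`; dial-space data have bottom vectors). [folklore] -/
theorem not_separates_of_exists_spaceReader_gt_subset (win : Window) {Φ : (Fin (win.N + 1) → ℝ) → ℝ}
    (hΦ : ∀ u, IsBottomVector (zetaDatum win) u → ContinuousAt Φ u)
    (hscale : ∀ t : ℝ, t ≠ 0 → ∀ u : Fin (win.N + 1) → ℝ, Φ (t • u) = Φ u) {θ : ℝ}
    (hθ : ∀ u, IsBottomVector (zetaDatum win) u → θ < Φ u) {S D : Set Datum}
    (hS : {d | ∃ u, IsBottomVector (d win) u ∧ θ < Φ u} ∩ arithDialSpace ⊆ S) (hD : arithDialSpace ⊆ D) :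
    ¬ Separates S D zetaDatum := by
  refine not_separates_of_robustWithin_arith hD
    (((robustWithin_dialSpace_spaceReader_gt win hΦ hscale hθ).anti arithDialSpace_subset_dialSpace).mono ?_)
  rintro d ⟨hd, hda⟩
  obtain ⟨u, hu, -⟩ := exists_isBottomVector_of_mem_dialSpace (arithDialSpace_subset_dialSpace hda) win
  exact hS ⟨⟨u, hu, hd u hu⟩, hda⟩

/-- **PROVED — readings strictly BELOW a threshold** (universal form). [folklore] -/
theorem not_separates_of_spaceReader_lt_subset (win : Window) {Φ : (Fin (win.N + 1) → ℝ) → ℝ}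
    (hΦ : ∀ u, IsBottomVector (zetaDatum win) u → ContinuousAt Φ u)
    (hscale : ∀ t : ℝ, t ≠ 0 → ∀ u : Fin (win.N + 1) → ℝ, Φ (t • u) = Φ u) {θ : ℝ}
    (hθ : ∀ u, IsBottomVector (zetaDatum win) u → Φ u < θ) {S D : Set Datum}
    (hS : {d | ∀ u, IsBottomVector (d win) u → Φ u < θ} ∩ arithDialSpace ⊆ S) (hD : arithDialSpace ⊆ D) :
    ¬ Separates S D zetaDatum := by
  have h := not_separates_of_spaceReader_gt_subset win (Φ := fun u => -Φ u) (θ := -θ)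
    (fun u hu => (hΦ u hu).neg) (fun t ht u => by simp only [hscale t ht u])
    (fun u hu => by linarith [hθ u hu]) (S := S) (D := D) ?_ hD
  · exact h
  · rintro d ⟨hd, hda⟩
    exact hS ⟨fun u hu => by have := hd u hu; linarith, hda⟩

/-- **PROVED — TWO-SIDED WINDOWS OF VALUES** (`θ₁ < Φ u < θ₂` for every bottom vector; joint class by
`RobustWithin.inter`). [folklore] -/
theorem not_separates_of_spaceReader_between_subset (win : Window) {Φ : (Fin (win.N + 1) → ℝ) → ℝ}
    (hΦ : ∀ u, IsBottomVector (zetaDatum win) u → ContinuousAt Φ u)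
    (hscale : ∀ t : ℝ, t ≠ 0 → ∀ u : Fin (win.N + 1) → ℝ, Φ (t • u) = Φ u) {θ₁ θ₂ : ℝ}
    (hθ₁ : ∀ u, IsBottomVector (zetaDatum win) u → θ₁ < Φ u) (hθ₂ : ∀ u, IsBottomVector (zetaDatum win) u → Φ u < θ₂)
    {S D : Set Datum} (hS : {d | ∀ u, IsBottomVector (d win) u → θ₁ < Φ u ∧ Φ u < θ₂} ∩ arithDialSpace ⊆ S)
    (hD : arithDialSpace ⊆ D) : ¬ Separates S D zetaDatum := by
  have h1 := robustWithin_dialSpace_spaceReader_gt win hΦ hscale hθ₁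
  have h2 := robustWithin_dialSpace_spaceReader_gt win (Φ := fun u => -Φ u) (θ := -θ₂)
    (fun u hu => (hΦ u hu).neg) (fun t ht u => by simp only [hscale t ht u]) (fun u hu => by linarith [hθ₂ u hu])
  refine not_separates_of_robustWithin_arith hD (((h1.inter h2).anti arithDialSpace_subset_dialSpace).mono ?_)
  rintro d ⟨⟨hd1, hd2⟩, hda⟩
  exact hS ⟨fun u hu => ⟨hd1 u hu, by have := hd2 u hu; linarith⟩, hda⟩

/-- **PROVED — ROBUSTNESS OF A JOINT READER OF THE BOTTOM VECTORS AT FINITELY MANY WINDOWS, BINDER-FREE**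
(`L_k × R0` transport / direction readers): `Φ` componentwise scale-free, continuous at every tuple of bottom
vectors of `ζ` at the listed windows and `> θ` at every such tuple. [folklore] -/
theorem robustWithin_dialSpace_tupleSpaceReader_gt {k : ℕ} (W : Fin k → Window)
    {Φ : ((i : Fin k) → (Fin ((W i).N + 1) → ℝ)) → ℝ}
    (hΦ : ∀ U : (i : Fin k) → (Fin ((W i).N + 1) → ℝ), (∀ i, IsBottomVector (zetaDatum (W i)) (U i)) →
      ContinuousAt Φ U)
    (hscale : ∀ t : Fin k → ℝ, (∀ i, t i ≠ 0) →
      ∀ U : (i : Fin k) → (Fin ((W i).N + 1) → ℝ), Φ (fun i => t i • U i) = Φ U)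
    {θ : ℝ} (hθ : ∀ U : (i : Fin k) → (Fin ((W i).N + 1) → ℝ), (∀ i, IsBottomVector (zetaDatum (W i)) (U i)) →
      θ < Φ U) :
    RobustWithin dialSpace {d | ∀ U : (i : Fin k) → (Fin ((W i).N + 1) → ℝ),
      (∀ i, IsBottomVector (d (W i)) (U i)) → θ < Φ U} zetaDatum := by
  obtain ⟨τ, hτ, hcone⟩ := exists_tau_tuple_gt_of_nearSpace (m := fun i => (W i).N + 1)
    (fun i => bottomSpace (zetaDatum (W i))) (fun i => isClosed_bottomSpace _)
    (fun U hU => hΦ U fun i => ⟨(hU i).2, (hU i).1⟩) hscale (fun U hU => hθ U fun i => ⟨(hU i).2, (hU i).1⟩)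
  refine (robustWithin_dialSpace_esToleranceClass_zeta W hτ).mono ?_
  rintro d ⟨hd, -⟩
  exact esToleranceClass_subset_forall_tuple (P := fun U => θ < Φ U) hcone hd

/-- **PROVED — THE WALL FOR A THRESHOLDED CONTINUOUS, COMPONENTWISE SCALE-FREE JOINT READER OF THE BOTTOM VECTORS AT
FINITELY MANY WINDOWS, NO GAP BINDERS, `ζ`'s reading strictly above the threshold at every tuple of its bottom
vectors** (universal form; dichotomy-carried, otherwise UNCONDITIONAL). Below a threshold: apply to `−Φ`. [folklore] -/
theorem not_separates_of_tupleSpaceReader_gt_subset {k : ℕ} (W : Fin k → Window)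
    {Φ : ((i : Fin k) → (Fin ((W i).N + 1) → ℝ)) → ℝ}
    (hΦ : ∀ U : (i : Fin k) → (Fin ((W i).N + 1) → ℝ), (∀ i, IsBottomVector (zetaDatum (W i)) (U i)) →
      ContinuousAt Φ U)
    (hscale : ∀ t : Fin k → ℝ, (∀ i, t i ≠ 0) →
      ∀ U : (i : Fin k) → (Fin ((W i).N + 1) → ℝ), Φ (fun i => t i • U i) = Φ U)
    {θ : ℝ} (hθ : ∀ U : (i : Fin k) → (Fin ((W i).N + 1) → ℝ), (∀ i, IsBottomVector (zetaDatum (W i)) (U i)) →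
      θ < Φ U) {S D : Set Datum}
    (hS : {d | ∀ U : (i : Fin k) → (Fin ((W i).N + 1) → ℝ), (∀ i, IsBottomVector (d (W i)) (U i)) → θ < Φ U} ∩
      arithDialSpace ⊆ S) (hD : arithDialSpace ⊆ D) : ¬ Separates S D zetaDatum :=
  not_separates_of_robustWithin_arith hD
    (((robustWithin_dialSpace_tupleSpaceReader_gt W hΦ hscale hθ).anti arithDialSpace_subset_dialSpace).mono hS)

end Summit.RiemannHypothesis.RiemannHypothesis.Theorems.PfPersistence

end
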